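import Summits.QuantumFields.YangMills.Theorems.SwapVirialDeficitZeroModeGroupFourSmallBallTwoScale
import Summits.QuantumFields.YangMills.Theorems.SwapVirialDeficitZeroModeGroupThreeGaussian
import HarnessLib

/-!
# Exact zero-mode rung, FOUR pairwise nearly commuting letters — IV-a: the UNIFORM dominating event of the two-scale family (sets and geometry)
# (zero-mode block of crux ⟨stmt-QuantumFields-24497⟩ `ToronTubeVolumeLaw`; free-hands support of ⟨stmt-QuantumFields-24197⟩ / ⟨24497⟩)

Part III rewrote `Haar⁴(N₄(t))/t⁶` as a cone integral of `vol³(T(η, ζ, κ))`, `T = twoScaleSet4`.  The analytic step the logarithm law needs next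
is dominated convergence in `η → 0`; this file and IV-b supply its MAJORANT: one event `domSet4 ⊇ T(η, ζ, κ)` for ALL `η, ζ, κ ≥ 0` (§11), of
FINITE volume (IV-b).  Here:
* §11 `pairSq x y = (x_Ky_I − x_Iy_K)² + (x_Iy_J − x_Jy_I)²`, `tvSq x = x_J² + x_K²`, ★ `domSet4` (`x₀² < 1`, `tvSq ≤ 1`, `pairSq ≤ 1` pairwise),
  ★ `twoScaleSet4_subset_domSet4`;
* §12 reduction to a REFERENCE letter (the one with the largest `tvSq`): `domRef`, the letter permutations `swapXY`, `swapXZ` (measure preserving),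
  ★ `volume_domSet4_le` : `vol³(domSet4) ≤ 3·vol³(domRef)`;
* §13 fibre geometry: `fibre4 x = {z | z₀² < 1, tvSq z ≤ tvSq x, pairSq x z ≤ 1}`, the Lagrange identity ★ `tvSq_mul_pairSq`
  (`|p|²|ξ_z p − ξ_x p_z|² = (ξ_z|p|² − ξ_x p·p_z)² + ξ_x²(p × p_z)²`), hence on the fibre `x_I²(p_x × p_z)² ≤ tvSq x` (transverse cutoff) and
  `(z_I·tvSq x − x_I·(p_x·p_z))² ≤ tvSq x` (the `I`-coordinate of `z` is confined to an interval of length `2/√(tvSq x)`); sections of `domRef`.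
HONEST LABEL: finite-dimensional measure theory on `SU(2)⁴` (plan-level zero-mode rung of DRAFT lines); NOT ⟨24497⟩, NOT ⟨24197⟩; the Yang–Mills mass gap
is NOT proved; no summit is proved by a line.  Seat ym-line-fcl-p3 g44 (cell ym-idea-1, free hands), `--supports stmt-QuantumFields-24197`.  Standard axioms.
References: [cite: GonzalezarroyoAltes1988]; [cite: Vanbaal2001]; [cite: Luscher1983, §2]; [folklore].
-/

set_option autoImplicit false

noncomputable section

open MeasureTheory Quaternion Set
open scoped Quaternion ENNReal BigOperators
open Literature.MathematicalPhysics.QuantumLattice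
open Summit.QuantumFields.YangMills.Theorems.SwapTwistDeficit.ToronLog

attribute [local instance] Literature.Analysis.FluidPDE.Tao2016.quatMeasurableSpace
  Literature.Analysis.FluidPDE.Tao2016.quatBorelSpace
  Literature.MathematicalPhysics.QuantumLattice.secondCountableTopology_su2

namespace Summit.QuantumFields.YangMills.Theorems.SwapVirialDeficit.ZeroModeGroup

/-! ## §11 The uniform dominating event -/

/-- The `η = κ = 0` pair functional `|ξ_y p_x − ξ_x p_y|² = (x_Ky_I − x_Iy_K)² + (x_Iy_J − x_Jy_I)²`. [folklore] -/
def pairSq (x y : ℍ) : ℝ := (x.imK * y.imI - x.imI * y.imK) ^ 2 + (x.imI * y.imJ - x.imJ * y.imI) ^ 2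

/-- Unfolding `pairSq`. [folklore] -/
theorem pairSq_def (x y : ℍ) : pairSq x y = (x.imK * y.imI - x.imI * y.imK) ^ 2 + (x.imI * y.imJ - x.imJ * y.imI) ^ 2 := rfl

/-- `pairSq` is symmetric. [folklore] -/
theorem pairSq_comm (x y : ℍ) : pairSq x y = pairSq y x := by unfold pairSq; ring

/-- `pairSq ≥ 0`. [folklore] -/
theorem pairSq_nonneg (x y : ℍ) : 0 ≤ pairSq x y := by unfold pairSq; positivity

/-- The transverse size `tvSq x = x_J² + x_K²`. [folklore] -/
def tvSq (x : ℍ) : ℝ := x.imJ ^ 2 + x.imK ^ 2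

/-- Unfolding `tvSq`. [folklore] -/
theorem tvSq_def (x : ℍ) : tvSq x = x.imJ ^ 2 + x.imK ^ 2 := rfl

/-- `tvSq ≥ 0`. [folklore] -/
theorem tvSq_nonneg (x : ℍ) : 0 ≤ tvSq x := by unfold tvSq; positivity

/-- `tvSq` is continuous. [folklore] -/
theorem continuous_tvSq : Continuous tvSq := by
  unfold tvSq; exact (Quaternion.continuous_imJ.pow 2).add (Quaternion.continuous_imK.pow 2)

/-- `pairSq` is jointly continuous. [folklore] -/
theorem continuous_pairSq : Continuous fun p : ℍ × ℍ => pairSq p.1 p.2 := by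
  unfold pairSq
  have hI1 : Continuous fun p : ℍ × ℍ => p.1.imI := Quaternion.continuous_imI.comp continuous_fst
  have hJ1 : Continuous fun p : ℍ × ℍ => p.1.imJ := Quaternion.continuous_imJ.comp continuous_fst
  have hK1 : Continuous fun p : ℍ × ℍ => p.1.imK := Quaternion.continuous_imK.comp continuous_fst
  have hI2 : Continuous fun p : ℍ × ℍ => p.2.imI := Quaternion.continuous_imI.comp continuous_snd
  have hJ2 : Continuous fun p : ℍ × ℍ => p.2.imJ := Quaternion.continuous_imJ.comp continuous_snd
  have hK2 : Continuous fun p : ℍ × ℍ => p.2.imK := Quaternion.continuous_imK.comp continuous_snd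
  exact (((hK1.mul hI2).sub (hI1.mul hK2)).pow 2).add (((hI1.mul hJ2).sub (hJ1.mul hI2)).pow 2)

/-- ★ **The uniform dominating event** `U ⊆ (ℍ × ℍ) × ℍ`: `x₀² < 1`, `tvSq x ≤ 1` for each letter and `pairSq ≤ 1` for each pair.  It contains
`T(η, ζ, κ)` for all `η, ζ, κ ≥ 0` and has finite volume (IV-b). [folklore] -/
def domSet4 : Set ((ℍ × ℍ) × ℍ) :=
  {w | w.1.1.re ^ 2 < 1 ∧ w.1.2.re ^ 2 < 1 ∧ w.2.re ^ 2 < 1 ∧ tvSq w.1.1 ≤ 1 ∧ tvSq w.1.2 ≤ 1 ∧ tvSq w.2 ≤ 1 ∧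
    pairSq w.1.1 w.1.2 ≤ 1 ∧ pairSq w.1.1 w.2 ≤ 1 ∧ pairSq w.1.2 w.2 ≤ 1}

/-- `x₀² ≤ M_{η,ζ}(x)` for `η, ζ ≥ 0`. [folklore] -/
theorem re_sq_le_tsNorm {η ζ : ℝ} (hη : 0 ≤ η) (hζ : 0 ≤ ζ) (x : ℍ) : x.re ^ 2 ≤ tsNorm η ζ x := by
  unfold tsNorm; nlinarith [sq_nonneg x.imI, sq_nonneg x.imJ, sq_nonneg x.imK, mul_nonneg hη (sq_nonneg x.imI),
    mul_nonneg hζ (add_nonneg (sq_nonneg x.imJ) (sq_nonneg x.imK))]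

/-- `0 ≤ M_{η,ζ}(x)` for `η, ζ ≥ 0`. [folklore] -/
theorem tsNorm_nonneg {η ζ : ℝ} (hη : 0 ≤ η) (hζ : 0 ≤ ζ) (x : ℍ) : 0 ≤ tsNorm η ζ x :=
  le_trans (sq_nonneg _) (re_sq_le_tsNorm hη hζ x)

/-- One pair: `pairSq x y + κ·C² ≤ M(x)M(y)` with `M(x) < 1`, `M(y) ∈ [0, 1)` and `κ ≥ 0` forces `pairSq x y ≤ 1`. [folklore] -/
theorem pairSq_le_one_of {κ Mx My C : ℝ} (hκ : 0 ≤ κ) (hMx1 : Mx < 1) (hMy0 : 0 ≤ My) (hMy1 : My < 1) {P : ℝ}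
    (hP : P + κ * C ^ 2 ≤ Mx * My) : P ≤ 1 := by
  nlinarith [mul_nonneg hκ (sq_nonneg C), mul_le_one₀ hMx1.le hMy0 hMy1.le]

/-- ★ **Uniform inclusion**: `T(η, ζ, κ) ⊆ U` for all `η, ζ, κ ≥ 0`. [folklore] -/
theorem twoScaleSet4_subset_domSet4 {η ζ κ : ℝ} (hη : 0 ≤ η) (hζ : 0 ≤ ζ) (hκ : 0 ≤ κ) : twoScaleSet4 η ζ κ ⊆ domSet4 := by
  rintro ⟨⟨x, y⟩, z⟩ hw
  simp only [twoScaleSet4, Set.mem_setOf_eq] at hw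
  obtain ⟨h1, h2, h3, h4, h5, h6, h7, h8, h9⟩ := hw
  have hy0 := tsNorm_nonneg hη hζ y; have hz0 := tsNorm_nonneg hη hζ z
  simp only [domSet4, Set.mem_setOf_eq, tvSq, pairSq]
  refine ⟨lt_of_le_of_lt (re_sq_le_tsNorm hη hζ x) h1, lt_of_le_of_lt (re_sq_le_tsNorm hη hζ y) h2,
    lt_of_le_of_lt (re_sq_le_tsNorm hη hζ z) h3, by linarith, by linarith, by linarith,
    pairSq_le_one_of hκ h1 hy0 h2 h7, pairSq_le_one_of hκ h1 hz0 h3 h8, pairSq_le_one_of hκ h2 hz0 h3 h9⟩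

/-- Measurability toolkit: the three letter projections. [folklore] -/
theorem measurable_letters :
    Measurable (fun w : (ℍ × ℍ) × ℍ => w.1.1) ∧ Measurable (fun w : (ℍ × ℍ) × ℍ => w.1.2) ∧ Measurable (fun w : (ℍ × ℍ) × ℍ => w.2) :=
  ⟨measurable_fst.comp measurable_fst, measurable_snd.comp measurable_fst, measurable_snd⟩

/-- `{w | pairSq (f w) (g w) ≤ c}` is measurable for measurable `f, g`. [folklore] -/
theorem measurableSet_pairSq_le {α : Type*} [MeasurableSpace α] {f g : α → ℍ} (hf : Measurable f) (hg : Measurable g) (c : ℝ) :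
    MeasurableSet {w | pairSq (f w) (g w) ≤ c} :=
  measurableSet_le (continuous_pairSq.measurable.comp (hf.prodMk hg)) measurable_const

/-- `{w | tvSq (f w) ≤ h w}` is measurable. [folklore] -/
theorem measurableSet_tvSq_le {α : Type*} [MeasurableSpace α] {f : α → ℍ} {h : α → ℝ} (hf : Measurable f) (hh : Measurable h) :
    MeasurableSet {w | tvSq (f w) ≤ h w} :=
  measurableSet_le (continuous_tvSq.measurable.comp hf) hh

/-- `{w | (f w)₀² < 1}` is measurable. [folklore] -/
theorem measurableSet_re_sq_lt {α : Type*} [MeasurableSpace α] {f : α → ℍ} (hf : Measurable f) :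
    MeasurableSet {w | (f w).re ^ 2 < 1} :=
  measurableSet_lt ((Quaternion.continuous_re.measurable.comp hf).pow_const 2) measurable_const

/-- `domSet4` is measurable. [folklore] -/
theorem measurableSet_domSet4 : MeasurableSet domSet4 := by
  obtain ⟨hx, hy, hz⟩ := measurable_letters
  unfold domSet4
  exact (measurableSet_re_sq_lt hx).inter ((measurableSet_re_sq_lt hy).inter ((measurableSet_re_sq_lt hz).inter
    ((measurableSet_tvSq_le hx measurable_const).inter ((measurableSet_tvSq_le hy measurable_const).inter
    ((measurableSet_tvSq_le hz measurable_const).inter ((measurableSet_pairSq_le hx hy 1).inter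
    ((measurableSet_pairSq_le hx hz 1).inter (measurableSet_pairSq_le hy hz 1))))))))

/-! ## §12 Reduction to a reference letter -/

/-- The part of `U` where the FIRST letter has the largest transverse size. [folklore] -/
def domRef : Set ((ℍ × ℍ) × ℍ) := {w | w ∈ domSet4 ∧ tvSq w.1.2 ≤ tvSq w.1.1 ∧ tvSq w.2 ≤ tvSq w.1.1}

/-- `domRef` is measurable. [folklore] -/
theorem measurableSet_domRef : MeasurableSet domRef := by
  obtain ⟨hx, hy, hz⟩ := measurable_letters
  unfold domRef
  exact measurableSet_domSet4.inter ((measurableSet_tvSq_le hy (continuous_tvSq.measurable.comp hx)).inter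
    (measurableSet_tvSq_le hz (continuous_tvSq.measurable.comp hx)))

/-- The letter permutation `((x, y), z) ↦ ((y, x), z)`. [folklore] -/
def swapXY (w : (ℍ × ℍ) × ℍ) : (ℍ × ℍ) × ℍ := ((w.1.2, w.1.1), w.2)

/-- The letter permutation `((x, y), z) ↦ ((z, y), x)`. [folklore] -/
def swapXZ (w : (ℍ × ℍ) × ℍ) : (ℍ × ℍ) × ℍ := ((w.2, w.1.2), w.1.1)

/-- `swapXY = Prod.swap × id`. [folklore] -/
theorem swapXY_eq : swapXY = Prod.map Prod.swap id := by funext w; rfl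

/-- `swapXZ` as a composite of the associator and two swaps. [folklore] -/
theorem swapXZ_eq : swapXZ = (Prod.map Prod.swap id) ∘ Prod.swap ∘ (MeasurableEquiv.prodAssoc : (ℍ × ℍ) × ℍ ≃ᵐ ℍ × ℍ × ℍ) := by
  funext w; rfl

/-- `swapXY` preserves `vol³`. [folklore] -/
theorem measurePreserving_swapXY :
    MeasurePreserving swapXY (((volume : Measure ℍ).prod (volume : Measure ℍ)).prod (volume : Measure ℍ))
      (((volume : Measure ℍ).prod (volume : Measure ℍ)).prod (volume : Measure ℍ)) := by
  rw [swapXY_eq]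
  exact (Measure.measurePreserving_swap (μ := (volume : Measure ℍ)) (ν := (volume : Measure ℍ))).prod (MeasurePreserving.id _)

/-- `swapXZ` preserves `vol³`. [folklore] -/
theorem measurePreserving_swapXZ :
    MeasurePreserving swapXZ (((volume : Measure ℍ).prod (volume : Measure ℍ)).prod (volume : Measure ℍ))
      (((volume : Measure ℍ).prod (volume : Measure ℍ)).prod (volume : Measure ℍ)) := by
  rw [swapXZ_eq]
  have hA : MeasurePreserving (MeasurableEquiv.prodAssoc : (ℍ × ℍ) × ℍ ≃ᵐ ℍ × ℍ × ℍ)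
      (((volume : Measure ℍ).prod (volume : Measure ℍ)).prod (volume : Measure ℍ))
      ((volume : Measure ℍ).prod ((volume : Measure ℍ).prod (volume : Measure ℍ))) :=
    ⟨MeasurableEquiv.prodAssoc.measurable, Measure.prodAssoc_prod⟩
  have hB := Measure.measurePreserving_swap (μ := (volume : Measure ℍ)) (ν := ((volume : Measure ℍ).prod (volume : Measure ℍ)))
  have hC := (Measure.measurePreserving_swap (μ := (volume : Measure ℍ)) (ν := (volume : Measure ℍ))).prod
    (MeasurePreserving.id (volume : Measure ℍ))
  exact hC.comp (hB.comp hA)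

/-- `U` is symmetric under `swapXY`. [folklore] -/
theorem swapXY_mem_domSet4 {w : (ℍ × ℍ) × ℍ} (hw : w ∈ domSet4) : swapXY w ∈ domSet4 := by
  obtain ⟨h1, h2, h3, h4, h5, h6, h7, h8, h9⟩ := hw
  refine ⟨h2, h1, h3, h5, h4, h6, ?_, ?_, ?_⟩
  · show pairSq w.1.2 w.1.1 ≤ 1; rwa [pairSq_comm]
  · exact h9
  · exact h8

/-- `U` is symmetric under `swapXZ`. [folklore] -/
theorem swapXZ_mem_domSet4 {w : (ℍ × ℍ) × ℍ} (hw : w ∈ domSet4) : swapXZ w ∈ domSet4 := by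
  obtain ⟨h1, h2, h3, h4, h5, h6, h7, h8, h9⟩ := hw
  refine ⟨h3, h2, h1, h6, h5, h4, ?_, ?_, ?_⟩
  · show pairSq w.2 w.1.2 ≤ 1; rwa [pairSq_comm]
  · show pairSq w.2 w.1.1 ≤ 1; rwa [pairSq_comm]
  · show pairSq w.1.2 w.1.1 ≤ 1; rwa [pairSq_comm]

/-- Some letter has the largest transverse size: `U ⊆ domRef ∪ swapXY⁻¹ domRef ∪ swapXZ⁻¹ domRef`. [folklore] -/
theorem domSet4_subset_union : domSet4 ⊆ domRef ∪ (swapXY ⁻¹' domRef ∪ swapXZ ⁻¹' domRef) := by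
  intro w hw
  by_cases hxy : tvSq w.1.2 ≤ tvSq w.1.1
  · by_cases hxz : tvSq w.2 ≤ tvSq w.1.1
    · exact Or.inl ⟨hw, hxy, hxz⟩
    · right; right
      refine ⟨swapXZ_mem_domSet4 hw, ?_, ?_⟩
      · show tvSq w.1.2 ≤ tvSq w.2; linarith [not_le.1 hxz]
      · show tvSq w.1.1 ≤ tvSq w.2; linarith [not_le.1 hxz]
  · by_cases hyz : tvSq w.2 ≤ tvSq w.1.2
    · right; left
      refine ⟨swapXY_mem_domSet4 hw, ?_, ?_⟩
      · show tvSq w.1.1 ≤ tvSq w.1.2; linarith [not_le.1 hxy]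
      · show tvSq w.2 ≤ tvSq w.1.2; exact hyz
    · right; right
      refine ⟨swapXZ_mem_domSet4 hw, ?_, ?_⟩
      · show tvSq w.1.2 ≤ tvSq w.2; linarith [not_le.1 hyz]
      · show tvSq w.1.1 ≤ tvSq w.2; linarith [not_le.1 hxy, not_le.1 hyz]

/-- ★ **Reduction to the reference letter**: `vol³(U) ≤ vol³(domRef) + vol³(domRef) + vol³(domRef)`. [folklore] -/
theorem volume_domSet4_le :
    (((volume : Measure ℍ).prod (volume : Measure ℍ)).prod (volume : Measure ℍ)) domSet4 ≤
      (((volume : Measure ℍ).prod (volume : Measure ℍ)).prod (volume : Measure ℍ)) domRef +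
      (((volume : Measure ℍ).prod (volume : Measure ℍ)).prod (volume : Measure ℍ)) domRef +
      (((volume : Measure ℍ).prod (volume : Measure ℍ)).prod (volume : Measure ℍ)) domRef := by
  have h1 := measurePreserving_swapXY.measure_preimage measurableSet_domRef.nullMeasurableSet
  have h2 := measurePreserving_swapXZ.measure_preimage measurableSet_domRef.nullMeasurableSet
  calc (((volume : Measure ℍ).prod (volume : Measure ℍ)).prod (volume : Measure ℍ)) domSet4
      ≤ (((volume : Measure ℍ).prod (volume : Measure ℍ)).prod (volume : Measure ℍ)) (domRef ∪ (swapXY ⁻¹' domRef ∪ swapXZ ⁻¹' domRef)) :=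
        measure_mono domSet4_subset_union
    _ ≤ (((volume : Measure ℍ).prod (volume : Measure ℍ)).prod (volume : Measure ℍ)) domRef +
          ((((volume : Measure ℍ).prod (volume : Measure ℍ)).prod (volume : Measure ℍ)) (swapXY ⁻¹' domRef) +
            (((volume : Measure ℍ).prod (volume : Measure ℍ)).prod (volume : Measure ℍ)) (swapXZ ⁻¹' domRef)) :=
        (measure_union_le _ _).trans (add_le_add le_rfl (measure_union_le _ _))
    _ = _ := by rw [h1, h2, add_assoc]

/-! ## §13 Fibre geometry of a non-reference letter -/

/-- The fibre of a non-reference letter `z` over the reference letter `x`: `z₀² < 1`, `tvSq z ≤ tvSq x`, `pairSq x z ≤ 1`. [folklore] -/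
def fibre4 (x : ℍ) : Set ℍ := {z | z.re ^ 2 < 1 ∧ tvSq z ≤ tvSq x ∧ pairSq x z ≤ 1}

/-- `fibre4 x` is measurable. [folklore] -/
theorem measurableSet_fibre4 (x : ℍ) : MeasurableSet (fibre4 x) := by
  unfold fibre4
  exact (measurableSet_re_sq_lt measurable_id).inter ((measurableSet_tvSq_le measurable_id measurable_const).inter
    (measurableSet_pairSq_le measurable_const measurable_id 1))

/-- The fibre is jointly measurable in `(x, z)`. [folklore] -/
theorem measurableSet_fibre4_joint : MeasurableSet {q : ℍ × ℍ | q.2 ∈ fibre4 q.1} := by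
  simp only [fibre4, Set.mem_setOf_eq]
  exact (measurableSet_re_sq_lt measurable_snd).inter ((measurableSet_tvSq_le measurable_snd (continuous_tvSq.measurable.comp measurable_fst)).inter
    (measurableSet_pairSq_le measurable_fst measurable_snd 1))

/-- **Sections of `domRef`**: over `(x, y)`, the `z`-section of `domRef` lies in `fibre4 x`, and is empty unless `x₀² < 1`, `tvSq x ≤ 1`
and `y ∈ fibre4 x`. [folklore] -/
theorem section_domRef {x y z : ℍ} (h : ((x, y), z) ∈ domRef) : (x.re ^ 2 < 1 ∧ tvSq x ≤ 1) ∧ y ∈ fibre4 x ∧ z ∈ fibre4 x := by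
  obtain ⟨⟨h1, h2, h3, h4, -, -, h7, h8, -⟩, hyx, hzx⟩ := h
  exact ⟨⟨h1, h4⟩, ⟨h2, hyx, h7⟩, ⟨h3, hzx, h8⟩⟩

/-- ★ **The Lagrange identity of the fibre**: `tvSq x · pairSq x z = (z_I·tvSq x − x_I·(x_Jz_J + x_Kz_K))² + x_I²·(x_Jz_K − x_Kz_J)²`
(`|p|²|q|² = (p·q)² + (p × q)²` for `p = (x_J, x_K)`, `q = ξ_z p − ξ_x p_z`). [folklore] -/
theorem tvSq_mul_pairSq (x z : ℍ) :
    tvSq x * pairSq x z = (z.imI * tvSq x - x.imI * (x.imJ * z.imJ + x.imK * z.imK)) ^ 2 + x.imI ^ 2 * (x.imJ * z.imK - x.imK * z.imJ) ^ 2 := by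
  unfold tvSq pairSq; ring

/-- **Transverse cutoff on the fibre**: `x_I²·(p_x × p_z)² ≤ tvSq x`. [folklore] -/
theorem cross_sq_le_of_mem_fibre4 {x z : ℍ} (hz : z ∈ fibre4 x) : x.imI ^ 2 * (x.imJ * z.imK - x.imK * z.imJ) ^ 2 ≤ tvSq x := by
  obtain ⟨-, -, hp⟩ := hz
  have hL := tvSq_mul_pairSq x z
  nlinarith [tvSq_nonneg x, sq_nonneg (z.imI * tvSq x - x.imI * (x.imJ * z.imJ + x.imK * z.imK)), mul_le_mul_of_nonneg_left hp (tvSq_nonneg x)]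

/-- **`I`-confinement on the fibre**: `(z_I·tvSq x − x_I·(p_x·p_z))² ≤ tvSq x`. [folklore] -/
theorem imI_sq_le_of_mem_fibre4 {x z : ℍ} (hz : z ∈ fibre4 x) :
    (z.imI * tvSq x - x.imI * (x.imJ * z.imJ + x.imK * z.imK)) ^ 2 ≤ tvSq x := by
  obtain ⟨-, -, hp⟩ := hz
  have hL := tvSq_mul_pairSq x z
  nlinarith [tvSq_nonneg x, sq_nonneg x.imI, mul_nonneg (sq_nonneg x.imI) (sq_nonneg (x.imJ * z.imK - x.imK * z.imJ)),
    mul_le_mul_of_nonneg_left hp (tvSq_nonneg x)]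

/-- The `I`-confinement as an interval: for `tvSq x = ρ² > 0`, `|z_I − x_I(p_x·p_z)/ρ²| ≤ 1/ρ`, i.e.
`z_I ∈ [c − 1/ρ, c + 1/ρ]` with `c = x_I(p_x·p_z)/ρ²`. [folklore] -/
theorem imI_mem_Icc_of_mem_fibre4 {x z : ℍ} (hz : z ∈ fibre4 x) (hρ : 0 < tvSq x) :
    z.imI ∈ Icc (x.imI * (x.imJ * z.imJ + x.imK * z.imK) / tvSq x - 1 / Real.sqrt (tvSq x))
      (x.imI * (x.imJ * z.imJ + x.imK * z.imK) / tvSq x + 1 / Real.sqrt (tvSq x)) := by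
  have h := imI_sq_le_of_mem_fibre4 hz
  set ρ2 := tvSq x with hρ2
  set d := x.imI * (x.imJ * z.imJ + x.imK * z.imK) with hd
  have hs : Real.sqrt ρ2 ^ 2 = ρ2 := Real.sq_sqrt hρ.le
  have hspos : 0 < Real.sqrt ρ2 := Real.sqrt_pos.2 hρ
  have hab : |z.imI * ρ2 - d| ≤ Real.sqrt ρ2 := by
    rw [← Real.sqrt_sq_eq_abs]; exact Real.sqrt_le_sqrt h
  have hab' := abs_le.1 hab
  have e1 : z.imI - d / ρ2 = (z.imI * ρ2 - d) / ρ2 := by field_simp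
  have key : |z.imI - d / ρ2| ≤ 1 / Real.sqrt ρ2 := by
    rw [e1, abs_div, abs_of_pos hρ, div_le_div_iff₀ hρ hspos, one_mul]
    calc |z.imI * ρ2 - d| * Real.sqrt ρ2 ≤ Real.sqrt ρ2 * Real.sqrt ρ2 := mul_le_mul_of_nonneg_right hab hspos.le
      _ = ρ2 := by rw [← sq, hs]
  obtain ⟨k1, k2⟩ := abs_le.1 key
  constructor <;> linarith

end Summit.QuantumFields.YangMills.Theorems.SwapVirialDeficit.ZeroModeGroup

end
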